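import Mathlib
import Literature.AlgebraicGeometry.Resolution.AugmentationIdeal
import Literature.AlgebraicGeometry.Resolution.AffineBlowup
import Literature.AlgebraicGeometry.Resolution.AffineBlowupCartier
import Literature.AlgebraicGeometry.Resolution.BlowupPrincipalCharts
import Literature.AlgebraicGeometry.Resolution.AffineBlowupAlgebra
import Literature.AlgebraicGeometry.Resolution.AffineBlowupReductionCover
import Summits.ResolutionOfSingularities.ResolutionOfSingularities.Theorems.WildQuotientsWildQuotientResolutionInvolutionKLTwice
import Summits.ResolutionOfSingularities.ResolutionOfSingularities.Theorems.WildQuotientsWildQuotientResolutionInvolutionReesParity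
import Summits.ResolutionOfSingularities.ResolutionOfSingularities.Theorems.WildQuotientsWildQuotientResolutionInvolutionChartDictionary

/-!
# The `y²`-charts cover `Bl_K(Spec R₊)` (card `mu2-strata-kl-twice`, (o1′) COVER)

(crux stmt-ResolutionOfSingularities-15640 `WildQuotients.WildQuotientResolution`, line `Sketch`,
sector `|G| = p`; RUNG V5 of `L/w45c/CHAIN.md` v8.4, brick B7/`HP₂` (ε) support;
res-L1-w45c-plan-1 ORDER 2026-08-27T13:09:50Z (o1′) «the COVER: `affineBlowup K` (over `R₊`) is
covered by the charts `y²`, `y` ranging over an anti-invariant generating set of `I_τ` … on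
`D₊(y_i y_j t)` both `y_i²/(y_iy_j)` and `y_j²/(y_iy_j)` are sections with product `1` ⇒ units ⇒
`D₊(y_iy_j t) ⊆ D₊(y_i² t)`». [OURS · L1 W4.5c] — NOT a statement of any manuscript; replaces the
role of no printed item. Prover res-L1-w45c-stub-3.)

Setting as in `…InvolutionChartDictionary`: `ι : R ≃+* R` an involution with `2 ∈ Rˣ`,
`j : S →+* R` injective with range the `ι`-fixed elements, `K := (augIdeal ι).comap j`.

* `BlowupExit.proj_iSup_basicOpen_eq_top_of_le_radical` — `D₊(f_i)` cover `Proj A` as soon as the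
  `f_i` generate the irrelevant ideal UP TO RADICAL (Mathlib's `Proj.iSup_basicOpen_eq_top` is the
  case without radical);
* `BlowupExit.affineBlowup_iSup_chartOpen_eq_top_of_sq_eq` — pure blow-up algebra: if
  `K = (m_p)_p` and `m_p² = d_{p.1} d_{p.2}` with all `d_k ∈ K`, the charts `D₊(d_k t)` cover
  `Bl_K(Spec S)` (in `S[Kt]`, `(m_p t)² = (d_{p.1} t)(d_{p.2} t)`, so the `d_k t` generate `S[Kt]₊`
  up to radical);
* `InvolutionExit.span_range_eq_comap_augIdeal` — for anti-invariant generators `(y_k)` of `I_ι`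
  and invariant preimages `m_{kl}` of the products `y_k y_l`, `K = (m_{kl})`;
* **`InvolutionExit.iSup_chartOpen_sq_eq_top`** — for anti-invariant generators `(y_k)_k` of `I_ι`
  and `d_k ∈ S` with `j d_k = y_k²`: `⨆ k, D₊(d_k t) = ⊤` on `affineBlowup K`;
  `iSup_chartOpen_sq_eq_top_of_anti` — the same indexed by ALL anti-invariant `y` (H1);
* `BlowupExit.affineBlowup_isRegular_of_iSup_chartOpen_eq_top` — cover assembly: charts `D₊(d_k t)`
  cover and all `S[K/d_k]` regular ⇒ `Scheme.IsRegular (affineBlowup K)`; hence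
  **`InvolutionExit.affineBlowup_isRegular_of_sq_charts`** — (ε) modulo
  `∀ k, IsRegularRing (S[K/d_k])`.
With `…InvolutionChartDictionary.exists_chartRingEquiv` ((o1): `S[K/d_k] ≃ (R[I_ι/y_k])^{ι}`), H5
and `isRegularRing_involutionChart` every chart of this cover is the spectrum of a regular ring.
-/

-- single-problem summit: the doubled namespace component `ResolutionOfSingularities` is forced
set_option linter.dupNamespace false

noncomputable section

open AlgebraicGeometry TopologicalSpace Literature.AlgebraicGeometry.Resolution

namespace Summit.ResolutionOfSingularities.ResolutionOfSingularities.Theorems.WildQuotientResolution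

namespace BlowupExit

/-- **`D₊(f_i)` cover `Proj A` when the `f_i` generate the irrelevant ideal up to radical.**
(Mathlib's `Proj.iSup_basicOpen_eq_top` with `≤ span` relaxed to `≤ (span _).radical`; same proof:
a point outside every `D₊(f_i)` is a relevant homogeneous prime containing all `f_i`.) [folklore] -/
theorem proj_iSup_basicOpen_eq_top_of_le_radical {A σ : Type*} [CommRing A] [SetLike σ A]
    [AddSubgroupClass σ A] (𝒜 : ℕ → σ) [GradedRing 𝒜] {κ : Type*} (f : κ → A)
    (hf : (HomogeneousIdeal.irrelevant 𝒜).toIdeal ≤ (Ideal.span (Set.range f)).radical) :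
    ⨆ i, Proj.basicOpen 𝒜 (f i) = ⊤ := by
  classical
  refine top_le_iff.mp fun x _ ↦ Opens.mem_iSup.mpr ?_
  by_contra! H
  simp only [Proj.mem_basicOpen, Decidable.not_not] at H
  refine x.not_irrelevant_le (hf.trans ?_)
  refine (Ideal.IsPrime.radical_le_iff x.isPrime).mpr ?_
  rwa [Ideal.span_le, Set.range_subset_iff]

/-- **Charts at "square roots of the generators' squares" cover.** If `K = (m_p)_{p : κ × κ}` with
`m_p² = d_{p.1} · d_{p.2}` and all `d_k ∈ K`, then the charts `D₊(d_k t)`, `k : κ`, cover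
`Bl_K(Spec S)`: in the Rees algebra `(m_p t)² = (d_{p.1} t)(d_{p.2} t)`, so the `d_k t` generate the
irrelevant ideal up to radical. (For an involution: `m_{kl} = y_k y_l`, `d_k = y_k²`.)
[OURS · L1 W4.5c] [folklore] -/
theorem affineBlowup_iSup_chartOpen_eq_top_of_sq_eq {S : Type} [CommRing S] {K : Ideal S}
    {κ : Type*} (d : κ → S) (hd : ∀ k, d k ∈ K) (m : κ × κ → S)
    (hm : Ideal.span (Set.range m) = K) (hsq : ∀ p, m p ^ 2 = d p.1 * d p.2) :
    ⨆ k, (affineBlowup.chartOpen (I := K) (d k) (hd k) : (affineBlowup K).Opens) = ⊤ := by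
  have hmK : ∀ p, m p ∈ K := fun p => hm ▸ Ideal.subset_span (Set.mem_range_self p)
  have : ∀ k, (affineBlowup.chartOpen (I := K) (d k) (hd k) : (affineBlowup K).Opens) =
      Proj.basicOpen (reesGrading K) (reesT (d k) (hd k)) :=
    fun k => affineBlowup.image_top_chartι _ _
  simp_rw [this]
  refine proj_iSup_basicOpen_eq_top_of_le_radical (reesGrading K) _
    ((irrelevant_le_span_reesT K).trans ?_)
  rw [Ideal.span_le]
  rintro _ ⟨c, rfl⟩
  have hspan : Ideal.span (Set.range fun p => reesT (I := K) (m p) (hmK p)) ≤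
      (Ideal.span (Set.range fun k => reesT (I := K) (d k) (hd k))).radical := by
    rw [Ideal.span_le]
    rintro _ ⟨p, rfl⟩
    have hsqT : reesT (I := K) (m p) (hmK p) ^ 2 =
        reesT (I := K) (d p.1) (hd p.1) * reesT (I := K) (d p.2) (hd p.2) := by
      apply Subtype.ext
      simp only [Subalgebra.coe_pow, Subalgebra.coe_mul, coe_reesT, Polynomial.monomial_pow,
        Polynomial.monomial_mul_monomial, hsq p]
    refine ⟨2, ?_⟩
    rw [hsqT]
    exact Ideal.mul_mem_left _ _ (Ideal.subset_span ⟨p.2, rfl⟩)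
  exact hspan (reesT_mem_span_range_reesT_of_span_eq m hm c.1 c.2)

/-- **Cover assembly**: `Bl_K(Spec S)` is a regular scheme as soon as the charts `D₊(d_k t)` of a
family `d_k ∈ K` COVER it and the affine blowup algebras `S[K/d_k]` are regular rings
(`(S[Kt])_{(d_k t)} ≅ S[K/d_k]`, `reesChartEquiv`; regularity is local). The tree's
`affineBlowup.isRegular_of_isRegularRing_blowupAlgebra_of_pow_le` is the case where the cover
comes from a reduction. [OURS · L1 W4.5c] [folklore] -/
theorem affineBlowup_isRegular_of_iSup_chartOpen_eq_top {S : Type} [CommRing S] {K : Ideal S}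
    {κ : Type*} (d : κ → S) (hd : ∀ k, d k ∈ K)
    (hcov : ⨆ k, (affineBlowup.chartOpen (I := K) (d k) (hd k) : (affineBlowup K).Opens) = ⊤)
    (hreg : ∀ k, IsRegularRing (blowupAlgebra K (d k))) : Scheme.IsRegular (affineBlowup K) := by
  refine Scheme.IsRegular.of_forall_exists_isOpenImmersion fun p => ?_
  have hp : p ∈ ⨆ k, (affineBlowup.chartOpen (I := K) (d k) (hd k) : (affineBlowup K).Opens) := by
    rw [hcov]; trivial
  obtain ⟨k, hk⟩ := Opens.mem_iSup.mp hp
  rw [show (affineBlowup.chartOpen (I := K) (d k) (hd k) : (affineBlowup K).Opens) =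
      Proj.basicOpen (reesGrading K) (reesT (d k) (hd k)) from
    affineBlowup.image_top_chartι _ _] at hk
  haveI : IsRegularRing
      (CommRingCat.of (HomogeneousLocalization.Away (reesGrading K) (reesT (d k) (hd k)))) :=
    haveI := hreg k
    IsRegularRing.of_ringEquiv (reesChartEquiv (d k) (hd k)).symm
  refine ⟨_, Proj.awayι (reesGrading K) (reesT (d k) (hd k)) (reesT_mem (d k) (hd k)) one_pos,
    inferInstance, ?_, Scheme.isRegular_Spec _⟩
  rw [← Scheme.Hom.coe_opensRange, Proj.opensRange_awayι]
  exact hk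

end BlowupExit

namespace InvolutionExit

variable {R S : Type} [CommRing R] [CommRing S] (ι : R ≃+* R) (hι : ∀ x, ι (ι x) = x)
  (j : S →+* R) (hj : Function.Injective j) (hfix : ∀ x : R, x ∈ j.range ↔ ι x = x)

include hι in
/-- `t ∈ K = I_ι.comap j` when `j t = y²` with `y` anti-invariant (`2` invertible). [folklore] -/
theorem sq_mem_comap_augIdeal (h2 : IsUnit (2 : R)) {y : R} {t : S} (hy : ι y = -y)
    (ht : j t = y ^ 2) : t ∈ (augIdeal ι).comap j := by
  rw [Ideal.mem_comap, ht, pow_two]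
  exact Ideal.mul_mem_left _ _ (mem_augIdeal_of_anti ι hι h2 hy)

include hι hj hfix in
/-- **`K = (y_k y_l)_{k,l}` contracted**: for anti-invariant generators `(y_k)` of `I_ι` and
invariant preimages `m_p ∈ S` of the products `y_{p.1} y_{p.2}`, `K := I_ι.comap j` is generated
by the `m_p` (`I_ι ∩ R₊ = I_ι² ∩ R₊`, `I_ι² = (y_k y_l) · R`, averaging). [OURS · L1 W4.5c] [folklore] -/
theorem span_range_eq_comap_augIdeal (h2 : IsUnit (2 : R)) {κ : Type*} (y : κ → R)
    (hspan : Ideal.span (Set.range y) = augIdeal ι) (m : κ × κ → S)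
    (hm : ∀ p, j (m p) = y p.1 * y p.2) :
    Ideal.span (Set.range m) = (augIdeal ι).comap j := by
  obtain ⟨u, hu⟩ := h2.exists_left_inv
  have hιu : ι u = u := apply_eq_self_of_mul_two ι hu
  apply le_antisymm
  · rw [Ideal.span_le]
    rintro _ ⟨p, rfl⟩
    rw [SetLike.mem_coe, Ideal.mem_comap, hm]
    exact Ideal.mul_mem_left _ _ (hspan ▸ Ideal.subset_span (Set.mem_range_self p.2))
  · intro k₀ hk₀
    have hjk : ι (j k₀) = j k₀ := apply_map_eq ι j hfix k₀
    have h1 : j k₀ ∈ augIdeal ι ^ 2 := by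
      have h := mem_pow_iff_mem_pow_two_mul_of_invariant ι hι h2 1 (j k₀) hjk
      rw [pow_one] at h
      exact h.mp (Ideal.mem_comap.mp hk₀)
    have h2le : augIdeal ι ^ 2 ≤ (Ideal.span (Set.range m)).map j := by
      rw [← hspan, pow_two, Ideal.span_mul_span']
      refine Ideal.span_le.mpr ?_
      rintro _ ⟨_, ⟨k, rfl⟩, _, ⟨l, rfl⟩, rfl⟩
      change y k * y l ∈ (Ideal.span (Set.range m)).map j
      rw [show y k * y l = j (m (k, l)) from (hm (k, l)).symm]
      exact Ideal.mem_map_of_mem _ (Ideal.subset_span ⟨(k, l), rfl⟩)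
    obtain ⟨κ', hκ', e⟩ := exists_eq_add_apply_of_mem_map ι hι j hfix (h2le h1) u
    rw [map_mul, hιu, hjk, ← two_mul, ← mul_assoc, mul_comm (2 : R) u, hu, one_mul] at e
    exact hj e ▸ hκ'

include hι hj hfix in
/-- **(o1′) The `y²`-charts cover `Bl_K(Spec R₊)`.** For anti-invariant generators `(y_k)_k` of
`I_ι` and `d_k ∈ S` with `j d_k = y_k²`, the charts `D₊(d_k t)` cover `affineBlowup (I_ι.comap j)`:
on `D₊(y_k y_l t)` the sections `y_k²/(y_k y_l)`, `y_l²/(y_k y_l)` have product `1`.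
[OURS · L1 W4.5c, card `mu2-strata-kl-twice` (o1′)] [folklore] -/
theorem iSup_chartOpen_sq_eq_top (h2 : IsUnit (2 : R)) {κ : Type*} (y : κ → R)
    (hy : ∀ k, ι (y k) = -y k) (hspan : Ideal.span (Set.range y) = augIdeal ι) (d : κ → S)
    (hd : ∀ k, j (d k) = y k ^ 2) :
    ⨆ k, (affineBlowup.chartOpen (I := (augIdeal ι).comap j) (d k)
      (sq_mem_comap_augIdeal ι hι j h2 (hy k) (hd k)) :
        (affineBlowup ((augIdeal ι).comap j)).Opens) = ⊤ := by
  -- invariant preimages of the products `y_k y_l`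
  have hex : ∀ p : κ × κ, ∃ m : S, j m = y p.1 * y p.2 := fun p =>
    exists_eq_of_invariant ι j hfix (by rw [map_mul, hy, hy, neg_mul_neg])
  choose m hm using hex
  refine BlowupExit.affineBlowup_iSup_chartOpen_eq_top_of_sq_eq d _ m
    (span_range_eq_comap_augIdeal ι hι j hj hfix h2 y hspan m hm) fun p => hj ?_
  rw [map_pow, hm, map_mul, hd, hd, mul_pow]

include hι hj hfix in
/-- (o1′) indexed by ALL anti-invariants (H1: they generate `I_ι`). [OURS · L1 W4.5c] [folklore] -/
theorem iSup_chartOpen_sq_eq_top_of_anti (h2 : IsUnit (2 : R)) (d : {y : R // ι y = -y} → S)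
    (hd : ∀ y, j (d y) = (y : R) ^ 2) :
    ⨆ y, (affineBlowup.chartOpen (I := (augIdeal ι).comap j) (d y)
      (sq_mem_comap_augIdeal ι hι j h2 y.2 (hd y)) :
        (affineBlowup ((augIdeal ι).comap j)).Opens) = ⊤ :=
  iSup_chartOpen_sq_eq_top ι hι j hj hfix h2 Subtype.val (fun y => y.2)
    (by rw [Subtype.range_val_subtype, augIdeal_eq_span_anti ι hι h2]) d hd

include hι hj hfix in
/-- **(ε) in ring form, modulo the chart rings.** `Bl_K(Spec R₊)` (`K = I_ι.comap j`) is a regular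
scheme as soon as the affine blowup algebras `S[K/d_k]` at the squares `j d_k = y_k²` of an
anti-invariant generating family `(y_k)` of `I_ι` are regular rings — which is what
`exists_chartRingEquiv` ((o1): `S[K/d_k] ≃ (R[I_ι/y_k])^{ι}`) + H5 + `isRegularRing_involutionChart`
deliver. [OURS · L1 W4.5c, card `mu2-strata-kl-twice` (o1′)/(ε)] [folklore] -/
theorem affineBlowup_isRegular_of_sq_charts (h2 : IsUnit (2 : R)) {κ : Type*} (y : κ → R)
    (hy : ∀ k, ι (y k) = -y k) (hspan : Ideal.span (Set.range y) = augIdeal ι) (d : κ → S)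
    (hd : ∀ k, j (d k) = y k ^ 2)
    (hreg : ∀ k, IsRegularRing (blowupAlgebra ((augIdeal ι).comap j) (d k))) :
    Scheme.IsRegular (affineBlowup ((augIdeal ι).comap j)) :=
  BlowupExit.affineBlowup_isRegular_of_iSup_chartOpen_eq_top d _
    (iSup_chartOpen_sq_eq_top ι hι j hj hfix h2 y hy hspan d hd) hreg

end InvolutionExit

end Summit.ResolutionOfSingularities.ResolutionOfSingularities.Theorems.WildQuotientResolution

end
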